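import Mathlib
import Literature.Geometry.Symplectic.JHolomorphicMap
import Literature.Geometry.Symplectic.JHolomorphicWeierstrass
import Summits.SmoothPoincare4.SmoothPoincare4.Theorems.SullivanDualWitnessChargeHelperAlphaLocal
import Summits.SmoothPoincare4.SmoothPoincare4.Theorems.SullivanDualWitnessChargeHelperAprioriLocal
import Summits.SmoothPoincare4.SmoothPoincare4.Theorems.SullivanDualWitnessChargeHelperSmoothLimitLocal
import Summits.SmoothPoincare4.SmoothPoincare4.Theorems.SullivanDualWitnessChargeHelperDerivBoundsLocal
import Summits.SmoothPoincare4.SmoothPoincare4.Theorems.SullivanDualWitnessChargeHelperGradBoundOfC0Aux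
import Summits.SmoothPoincare4.SmoothPoincare4.Theorems.SullivanDualWitnessChargeHelperGradBoundOfC0

/-!
# The generalized Weierstraß theorem for `J`-holomorphic maps, flat `ℝ⁴` form — PROVED

Crux `WitnessCharge` (stmt-SmoothPoincare4-7824), line `Sketch` (idea `pencil-incompleteness`),
continuation lead c2, cycle 3. This file DISCHARGES the named fact
`Literature.Geometry.Symplectic.JHolomorphicWeierstrassR4` (Hummel 1997, Ch. III Prop. 3.1 in the
flat four-dimensional special case recorded in `Literature/Geometry/Symplectic/JHolomorphicWeierstrass.lean`):
for a `C^∞` almost complex structure `J` on `ℝ⁴`, maps `u n : ℂ → ℝ⁴` that are `C^∞` and flat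
`J`-holomorphic on an open `U ⊆ ℂ` and converge locally uniformly on `U` to `v` have a limit that
is `C^∞` and `J`-holomorphic on `U`, and `d(u n) → dv` locally uniformly on `U`.

It is the input L3 ("Gromov–Schwarz / elliptic regularity") of the rescaling branch of the line
(`helper_rescaleLocal`, `helper_rescaleAway`, which take it as a hypothesis) and of the cruxes
`TameOrBrodyR4` / `HyperbolicEnd` of the same route.

## Proof (assembled from the registered helper stubs of wave 1)

* `helper_alphaLocal` + `helper_aprioriLocal_of`: the `L²` elliptic bootstrapping chain landed for
  `TameOrBrodyR4` (`…TameOrBrodyR4Apriori*`: two integrations by parts, Ladyzhenskaya, a sup bound,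
  induction `α α β α γ`), LOCALISED — the equation is only used on the open disc of radius `2` —
  gives `‖Dᵏg(0)‖ ≤ C(J, R₀, k)` for `g` smooth, `J`-holomorphic on that disc, `‖g‖ ≤ R₀` and
  `‖dg‖ ≤ 2` on the closed unit disc (McDuff–Salamon 2012, Thm B.4.2 with `p = ∞`, in `L²` form).
* `helper_derivBoundsLocal_of`: cover a compact `K ⊆ U`, translate, rescale and cut off, to get
  bounds on all derivatives on `K`, uniform in `n`, from `C⁰` and `C¹` bounds on compacts.
* `helper_gradBoundOfC0_of`: `C⁰_loc` convergence forces the `C¹` bounds (Zalcman rescaling at a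
  blow-up point would produce maps with unit gradient at the origin converging in `C¹` to a
  constant).
* `helper_smoothLimitLocal`: derivative bounds + locally uniform convergence ⇒ the limit is `C^∞`
  on `U` and the first derivatives converge locally uniformly; the equation passes to the limit
  pointwise.
-/

noncomputable section

set_option linter.dupNamespace false

open scoped ContDiff Topology
open Filter Set Metric Literature.Geometry.Symplectic

namespace Summit.SmoothPoincare4.SmoothPoincare4.Theorems.WitnessCharge.PencilIncompleteness

/-- **`C⁰` bounds on compact subsets** for maps continuous on an open `U` converging locally
uniformly on `U`. -/
theorem weierstrass_c0Bound {U : Set ℂ} (hU : IsOpen U)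
    {u : ℕ → ℂ → EuclideanSpace ℝ (Fin 4)} {v : ℂ → EuclideanSpace ℝ (Fin 4)}
    (hu : ∀ n, ContinuousOn (u n) U) (hlim : TendstoLocallyUniformlyOn u v atTop U) :
    ∀ K : Set ℂ, IsCompact K → K ⊆ U →
      ∃ R : ℝ, ∀ n, ∀ z ∈ K, ‖u n z‖ ≤ R := by
  intro K hK hKU
  have hunif : TendstoUniformlyOn u v atTop K :=
    (tendstoLocallyUniformlyOn_iff_forall_isCompact hU).mp hlim K hKU hK
  exact GradBound.exists_bound_of_tendstoUniformlyOn hK (fun n => (hu n).mono hKU) hunif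

/-- **The generalized Weierstraß theorem for flat `J`-holomorphic maps into `ℝ⁴` (Hummel 1997,
Ch. III Prop. 3.1; McDuff–Salamon 2012, Thm B.4.2): the named fact
`Literature.Geometry.Symplectic.JHolomorphicWeierstrassR4` holds.** -/
theorem jHolomorphicWeierstrassR4_holds : JHolomorphicWeierstrassR4 := by
  intro J hJs hJ2 U hU u v hu huJ hlim
  -- the four analytic inputs
  have hAPL := helper_aprioriLocal_of helper_alphaLocal
  have hDBL := helper_derivBoundsLocal_of hAPL
  have hGB := helper_gradBoundOfC0_of hDBL helper_smoothLimitLocal J hJs hJ2 U hU u v hu huJ hlim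
  have hC0 := weierstrass_c0Bound hU (fun n => (hu n).continuousOn) hlim
  have hD := hDBL J hJs hJ2 U hU u hu huJ hC0 hGB
  obtain ⟨hv, hd⟩ := helper_smoothLimitLocal U hU u v hu hD hlim
  refine ⟨hv, fun z hz ζ => ?_, hd⟩
  -- the equation passes to the limit pointwise
  have hev : Continuous fun p : (EuclideanSpace ℝ (Fin 4) →L[ℝ] EuclideanSpace ℝ (Fin 4)) ×
      EuclideanSpace ℝ (Fin 4) => p.1 p.2 :=
    isBoundedBilinearMap_apply.continuous
  have hTz : Tendsto (fun n => fderiv ℝ (u n) z) atTop (𝓝 (fderiv ℝ v z)) := hd.tendsto_at hz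
  have huz : Tendsto (fun n => u n z) atTop (𝓝 (v z)) := hlim.tendsto_at hz
  have h1 : Tendsto (fun n => fderiv ℝ (u n) z (Complex.I * ζ)) atTop
      (𝓝 (fderiv ℝ v z (Complex.I * ζ))) :=
    ((continuous_id.clm_apply continuous_const).tendsto (fderiv ℝ v z)).comp hTz
  have h2 : Tendsto (fun n => J (u n z) (fderiv ℝ (u n) z ζ)) atTop
      (𝓝 (J (v z) (fderiv ℝ v z ζ))) := by
    have hJt : Tendsto (fun n => J (u n z)) atTop (𝓝 (J (v z))) :=
      (hJs.continuous.tendsto (v z)).comp huz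
    have hdζ : Tendsto (fun n => fderiv ℝ (u n) z ζ) atTop (𝓝 (fderiv ℝ v z ζ)) :=
      ((continuous_id.clm_apply continuous_const).tendsto (fderiv ℝ v z)).comp hTz
    exact (hev.tendsto (J (v z), fderiv ℝ v z ζ)).comp (hJt.prodMk_nhds hdζ)
  have heq : (fun n => fderiv ℝ (u n) z (Complex.I * ζ)) =
      fun n => J (u n z) (fderiv ℝ (u n) z ζ) := funext fun n => huJ n z hz ζ
  rw [heq] at h1
  exact tendsto_nhds_unique h1 h2

end Summit.SmoothPoincare4.SmoothPoincare4.Theorems.WitnessCharge.PencilIncompleteness
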